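import Summits.Ventures.DiscreteObjects.PP12.FlagOrbitMatrix
import Mathlib.Algebra.Order.BigOperators.Group.Finset

/-!
# The generic flag-cell orbit-matrix statement is a FINITE statement: entries are at most 2 (kernel; bookkeeping for the engines)
Framing: lottery ticket; floor = certified bounds/negative ranges.

Cell pub-namedobj (venture DiscreteObjects), target (M), designs gen 15. `IsFlagOrbitMatrix ρ M` (`FlagOrbitMatrix`, p344983) quantifies over
`M : FRow ρ → FCol ρ → ℕ`; this file shows that the row totals and row norms already bound every entry by `2`
(`IsFlagOrbitMatrix.entry_le_two`: an entry `a ≥ 3` would give `Σ M² ≥ a² + (Σ M − a) ≥ Σ M + 6`, but `Σ M² ≤ Σ M + 2` for every row type),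
so `NoFlagOrbitMatrix ρ` is equivalent to a statement quantified over the FINITE type `FRow ρ → FCol ρ → Fin 3`
(`noFlagOrbitMatrix_iff_fin`) — the form an exhaustive / SAT engine decides, and the form a kernel certificate would take. Also: c-line rows and
T-line rows are `0/1` rows and every side row has norm `15` and total `13`, i.e. exactly one entry `2` (its own triangle, conjunct 7) and eleven
entries `1` (`IsFlagOrbitMatrix.side_row_sq_sub`). Nothing here decides any `NoFlagOrbitMatrix ρ`. No `sorry`, no new axioms.
-/

namespace Summit.Ventures.DiscreteObjects.PP12

open Finset

namespace IsFlagOrbitMatrix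

variable {ρ : ℕ} {M : FRow ρ → FCol ρ → ℕ}

/-- Row norm exceeds row total by at most `2`: `Σ_c M r c · M r c ≤ Σ_c M r c + 2` (equality for side rows, norm = total otherwise). -/
theorem row_sq_le_sum_add_two (h : IsFlagOrbitMatrix ρ M) (r : FRow ρ) :
    ∑ c : FCol ρ, M r c * M r c ≤ ∑ c : FCol ρ, M r c + 2 := by
  rw [h.2.2.1 r r, h.1 r]
  rcases r with s | x | ⟨k, t⟩ <;> simp [FlagOrbit.rowTarget, FlagOrbit.rowSum]

/-- For c-line rows and T-line rows the norm equals the total. -/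
theorem row_sq_eq_sum_of_not_side (h : IsFlagOrbitMatrix ρ M) (r : FRow ρ) (hr : ∀ x : Fin ρ × Fin 12, r ≠ Sum.inr (Sum.inl x)) :
    ∑ c : FCol ρ, M r c * M r c = ∑ c : FCol ρ, M r c := by
  rw [h.2.2.1 r r, h.1 r]
  rcases r with s | x | ⟨k, t⟩
  · simp [FlagOrbit.rowTarget, FlagOrbit.rowSum]
  · exact absurd rfl (hr x)
  · simp [FlagOrbit.rowTarget, FlagOrbit.rowSum]

/-- **Every entry of a flag-cell orbit matrix is at most `2`.** -/
theorem entry_le_two (h : IsFlagOrbitMatrix ρ M) (r : FRow ρ) (c₀ : FCol ρ) : M r c₀ ≤ 2 := by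
  by_contra hlt
  push Not at hlt
  have hsq := row_sq_le_sum_add_two h r
  -- split off the column c₀ from both sums
  have h1 : ∑ c : FCol ρ, M r c * M r c = M r c₀ * M r c₀ + ∑ c ∈ univ.erase c₀, M r c * M r c :=
    (Finset.add_sum_erase univ (fun c => M r c * M r c) (mem_univ c₀)).symm
  have h2 : ∑ c : FCol ρ, M r c = M r c₀ + ∑ c ∈ univ.erase c₀, M r c :=
    (Finset.add_sum_erase univ (fun c => M r c) (mem_univ c₀)).symm
  have h3 : ∑ c ∈ univ.erase c₀, M r c ≤ ∑ c ∈ univ.erase c₀, M r c * M r c :=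
    Finset.sum_le_sum fun c _ => Nat.le_mul_self (M r c)
  have h4 : 3 * M r c₀ ≤ M r c₀ * M r c₀ := Nat.mul_le_mul_right _ hlt
  rw [h1, h2] at hsq
  omega

/-- The entry bound packaged: an orbit matrix is a function into `{0, 1, 2}`. -/
theorem entry_lt_three (h : IsFlagOrbitMatrix ρ M) (r : FRow ρ) (c₀ : FCol ρ) : M r c₀ < 3 :=
  Nat.lt_succ_of_le (entry_le_two h r c₀)

/-- **c-line rows and T-line rows are `0/1` rows** (norm = total). -/
theorem entry_le_one_of_not_side (h : IsFlagOrbitMatrix ρ M) (r : FRow ρ) (hr : ∀ x : Fin ρ × Fin 12, r ≠ Sum.inr (Sum.inl x))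
    (c₀ : FCol ρ) : M r c₀ ≤ 1 := by
  by_contra hlt
  push Not at hlt
  have hsq := row_sq_eq_sum_of_not_side h r hr
  have h1 : ∑ c : FCol ρ, M r c * M r c = M r c₀ * M r c₀ + ∑ c ∈ univ.erase c₀, M r c * M r c :=
    (Finset.add_sum_erase univ (fun c => M r c * M r c) (mem_univ c₀)).symm
  have h2 : ∑ c : FCol ρ, M r c = M r c₀ + ∑ c ∈ univ.erase c₀, M r c :=
    (Finset.add_sum_erase univ (fun c => M r c) (mem_univ c₀)).symm
  have h3 : ∑ c ∈ univ.erase c₀, M r c ≤ ∑ c ∈ univ.erase c₀, M r c * M r c :=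
    Finset.sum_le_sum fun c _ => Nat.le_mul_self (M r c)
  have h4 : 2 * M r c₀ ≤ M r c₀ * M r c₀ := Nat.mul_le_mul_right _ hlt
  rw [h1, h2] at hsq
  omega

/-- **Side rows:** `Σ_c M (M − 1) = 2` — exactly one entry `2` (the own triangle, conjunct 7) and otherwise `0/1`. -/
theorem side_row_sq_sub (h : IsFlagOrbitMatrix ρ M) (x : Fin ρ × Fin 12) :
    ∑ c : FCol ρ, M (Sum.inr (Sum.inl x)) c * M (Sum.inr (Sum.inl x)) c = ∑ c : FCol ρ, M (Sum.inr (Sum.inl x)) c + 2 := by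
  rw [h.2.2.1, h.1]; simp [FlagOrbit.rowTarget, FlagOrbit.rowSum]

end IsFlagOrbitMatrix

/-- **`NoFlagOrbitMatrix ρ` is a statement about the FINITE type `FRow ρ → FCol ρ → Fin 3`** (entries `0, 1, 2`). -/
theorem noFlagOrbitMatrix_iff_fin (ρ : ℕ) :
    NoFlagOrbitMatrix ρ ↔ ∀ M : FRow ρ → FCol ρ → Fin 3, ¬ IsFlagOrbitMatrix ρ (fun r c => (M r c : ℕ)) := by
  constructor
  · intro h M hM
    exact h _ hM
  · intro h M hM
    refine h (fun r c => ⟨M r c, IsFlagOrbitMatrix.entry_lt_three hM r c⟩) ?_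
    exact hM

/-- The finite type of candidate matrices is indeed a `Fintype` (so `NoFlagOrbitMatrix ρ` is a finite conjunction of decidable checks; its size
`3 ^ ((ρ + 48)²)` puts a brute-force `decide` out of reach — the census engines work on the equations instead). -/
example (ρ : ℕ) : Fintype (FRow ρ → FCol ρ → Fin 3) := inferInstance

end Summit.Ventures.DiscreteObjects.PP12
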